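import Mathlib.RingTheory.Valuation.ExtendToLocalization
import Mathlib.RingTheory.Valuation.Integers
import Literature.AlgebraicGeometry.Resolution.AffineBlowupAlgebra
import HarnessLib

/-!
# [OURS · L1 W4.5(b) · EL♮] K-VAL-CENTRE: the centre of a valuation on a blow-up chart `R[J/a]` lies on the hyperplane
# `{g/a = 0}` exactly when `v(g) > v(a)` — abstract `Valuation` lemma over the tree's `blowupAlgebra`
# (crux `EquisingularLiftNat` = stmt-ResolutionOfSingularities-20038; PARENT ≥ 4 band / kill test #50 K5-BMY, door (d♯))

HONEST FRAMING. OURS (cell res-hironaka, crux chain w45b, slot W4.5(b)); NOT a statement of any manuscript; replaces the role of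
NOTHING in the manuscript; AI-written, AI review is weaker than expert review. Helper `--supports stmt-ResolutionOfSingularities-20038
--as helper`. Object «(α)» of res-L1-w45b-lead-1's NOTE + OFFER 2026-08-27T19:20:33Z / res-L1-w45b-plan-1's NAMING 19:21:12Z, taken by
res-D-brk-4 g9: it closes the by-hand step (2a) of `DSHARP-VOID.md` §2 («RIBBON AT A GOOD POINT ⇒ the `v`-centre JUMPS ONTO THE BAD
LINE: the centre of `v` on `P_{j+1}` lies in the chart `y₁` (`v(y₁) = v(J)`), at the prime `𝔓_v = {v > 0}` of `A[J/y₁]`; `𝔓_v ⊇ 𝔪_A`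
and `g/y₁ ∈ 𝔓_v` since `v(g) > v(y₁)`») by supplying, from VALUATION data alone, the two hypotheses `hM` / `hw` of K-RIBBON-BAD
(`RibbonBad.algebraMap_mem_sq`, `RibbonBad.exists_point_bad_of_ribbon`, p557704).

THE SETTING (multiplicative notation of Mathlib's `Valuation R Γ`, so «`v(g) > v(a)`» of the memo reads `v g < v a` and «`v ≥ 0` on
`R`» reads `v r ≤ 1`). `R` is any commutative ring and `v : Valuation R Γ` may have a SUPPORT — this is what the application needs: there
`R = 𝒪_{P_j,η}` is the regular ambient stalk and `v` is the divisorial valuation of the exceptional conic on the function field of the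
hypersurface `Y_j`, pulled back to `R` along `R ↠ 𝒪_{Y_j,η}` (support = the prime of `Y_j`). For `v a ≠ 0` the valuation extends
uniquely to `R[1/a]` (Mathlib `Valuation.extendToLocalization`; here any `w` on `Localization.Away a` with `w ∘ algebraMap = v`), and
we restrict it to the affine blow-up algebra `R[J/a] ⊆ R[1/a]` of the tree (`blowupAlgebra J a`, image model, [GortzWedhorn2020, (13.19)]).

THE THEOREMS (all sorry-free, def-free).
* `exists_valuation_away` / `valuation_away_unique` — existence and uniqueness of the extension `w` of `v` to `R[1/a]` (`v a ≠ 0`);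
  `apply_div` — `w (x/a) = v x · (v a)⁻¹`.
* `le_one_of_mem_blowupAlgebra` — if `v ≤ 1` on `R` and `v x ≤ v a` on `J` («`v(a) = v(J)` minimal»), then `w ≤ 1` on `R[J/a]`
  (`R[J/a]` lies in the valuation ring of `w`); `forall_mem_span_le` reduces the hypothesis on `J` to generators.
* `exists_centre` — THE CENTRE: there is a prime `𝔓_v` of `R[J/a]` with `z ∈ 𝔓_v ↔ w z < 1`; and for ANY ideal `𝔓` with this
  membership rule: `algebraMap_mem_centre_iff` (`r/1 ∈ 𝔓 ↔ v r < 1`, so `𝔓 ∩ R` is the centre of `v` on `R`), `map_le_centre_iff`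
  (`M·R[J/a] ≤ 𝔓 ↔ v < 1` on `M` — hypothesis `hM` of K-RIBBON-BAD), `div_mem_centre_iff` (`g/a ∈ 𝔓 ↔ v g < v a`) and
  `algebraMap_mem_centre_mul_span_iff` (`g/1 ∈ 𝔓·(a) ↔ v g < v a` for `g ∈ J` — hypothesis `hw` of K-RIBBON-BAD, the hyperplane
  `{g/a = 0}` of the exceptional fibre); local form `comap_centre_eq_maximalIdeal` (`𝔓 ∩ R = 𝔪` when `v` is centred at `𝔪`).
* `centre_unique` — UNIQUENESS OF THE CENTRE ON THE CHART: a prime `𝔮` of `R[J/a]` at which some `Γ`-valued valuation `w′` of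
  `R[J/a]` extending `v` is centred (`z ∈ 𝔮 ↔ w′ z < 1`) equals `𝔓_v` (indeed `w′ = w|_{R[J/a]}`, `valuation_blowupAlgebra_unique`).
* `exists_valuation_atPrime` — DOMINATION: `w` extends to every localisation `L` of `R[J/a]` at `𝔓_v` (`IsLocalization.AtPrime L 𝔓_v`,
  e.g. the stalk of the blown-up scheme at the corresponding point) with `≤ 1` on `L` and `< 1` exactly on `𝔪_L` — the ring-level
  meaning of «`v` is centred at that point».
* `exists_centre_ribbon` — THE PACKAGE CONSUMED BY K-RIBBON-BAD: for `R` local with `v` centred at `𝔪`, `a ∈ J`, `v ≤ 1` on `R`,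
  `v a ≠ 0`, `v ≤ v a` on `J` and a member `g ∈ J` with `v g < v a`: a `PrimeSpectrum` point `𝔓` of `R[J/a]` with
  `𝔪·R[J/a] ≤ 𝔓`, `𝔓 ∩ R = 𝔪`, `g/1 ∈ 𝔓·(a)` and `z ∈ 𝔓 ↔ w z < 1`. Feeding it to `RibbonBad.exists_point_bad_of_ribbon` gives: after
  a ribbon touch, the chart point UNDER THE `v`-CENTRE is a BAD point of the blowing up (scheme-level sequel in a sibling file).

References: O. Zariski, P. Samuel, *Commutative Algebra II*, Ch. VI §5 (centre of a valuation / place on a ring) [ZariskiSamuel1960];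
tree `…Resolution/LocalBlowup.lean` (`subringCentre`, the field-embedded twin for subrings of a valuation ring; [NovacoskiSpivakovsky2014,
Def. 2.8/2.11]: «along an ideal `I = (u₀,…,u_q)` with `ν(u₀)` minimal, `R′ = R[u₁/u₀,…]`, `m′ = m_ν ∩ R′`»); `…AffineBlowupAlgebra`
(`blowupAlgebra`, `div_mem_blowupAlgebra`, `algebraMap_mem_nonZeroDivisors_blowupAlgebra`); [GortzWedhorn2020, (13.19)];
[StacksProject, Tag 052Q/07Z3/00PH].
-/

set_option linter.dupNamespace false -- mandated namespace `Summit.<Summit>.<Problem>` of this single-conjunct summit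

noncomputable section

universe u v

open IsLocalRing IsLocalization
open Literature.AlgebraicGeometry.Resolution

namespace Summit.ResolutionOfSingularities.ResolutionOfSingularities.Cruxes.EquisingularLiftNat.Sections

namespace ValChartCentre

variable {R : Type u} [CommRing R] {Γ : Type v} [LinearOrderedCommGroupWithZero Γ]

/-! ## Values in `Γ`: two elementary rewrites -/

/-- `b · c⁻¹ < 1 ↔ b < c` for `c ≠ 0` in a linearly ordered commutative group with zero. [folklore] -/
theorem mul_inv_lt_one_iff {b c : Γ} (hc : c ≠ 0) : b * c⁻¹ < 1 ↔ b < c := by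
  rw [mul_inv_lt_iff₀ (zero_lt_iff.mpr hc), one_mul]

/-- `b · c⁻¹ ≤ 1 ↔ b ≤ c` for `c ≠ 0` in a linearly ordered commutative group with zero. [folklore] -/
theorem mul_inv_le_one_iff {b c : Γ} (hc : c ≠ 0) : b * c⁻¹ ≤ 1 ↔ b ≤ c := by
  rw [mul_inv_le_iff₀ (zero_lt_iff.mpr hc), one_mul]

/-- `x ≤ 1` and `y < 1` give `x · y < 1`. [folklore] -/
theorem mul_lt_one_of_le_of_lt {x y : Γ} (hx : x ≤ 1) (hy : y < 1) : x * y < 1 :=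
  lt_of_le_of_lt (by simpa only [one_mul] using mul_le_mul_left hx y) hy

/-! ## The valuation on an ideal from its values on generators -/

/-- If `v ≤ 1` on `R` and `v s ≤ v a` for the generators `s ∈ S` of `J = (S)`, then `v x ≤ v a` for every `x ∈ J`
(«`v(a) = v(J)` is attained on a generator»). [folklore] -/
theorem forall_mem_span_le (v : Valuation R Γ) (hR : ∀ r, v r ≤ 1) {S : Set R} {a : R} (hS : ∀ s ∈ S, v s ≤ v a) :
    ∀ x ∈ Ideal.span S, v x ≤ v a := by
  intro x hx
  induction hx using Submodule.span_induction with
  | mem s hs => exact hS s hs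
  | zero => simp
  | add x y _ _ hx hy => exact le_trans (v.map_add x y) (max_le hx hy)
  | smul c x _ hx =>
      rw [smul_eq_mul, Valuation.map_mul]
      calc v c * v x ≤ 1 * v x := mul_le_mul_left (hR c) _
        _ = v x := one_mul _
        _ ≤ v a := hx

/-! ## Extension of `v` to `R[1/a]` -/

/-- For `v a ≠ 0` the powers of `a` avoid the support of `v`. [folklore] -/
theorem powers_le_supp_primeCompl (v : Valuation R Γ) {a : R} (ha : v a ≠ 0) :
    Submonoid.powers a ≤ v.supp.primeCompl := by
  rintro x ⟨n, rfl⟩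
  show a ^ n ∉ v.supp
  rw [Valuation.mem_supp_iff, Valuation.map_pow]
  exact pow_ne_zero n ha

/-- **Existence of the extension**: for `v a ≠ 0` some valuation `w` of `R[1/a]` restricts to `v`
(Mathlib `Valuation.extendToLocalization`). [folklore] -/
theorem exists_valuation_away (v : Valuation R Γ) {a : R} (ha : v a ≠ 0) :
    ∃ w : Valuation (Localization.Away a) Γ, ∀ r, w (algebraMap R (Localization.Away a) r) = v r :=
  ⟨v.extendToLocalization (S := Submonoid.powers a) (powers_le_supp_primeCompl v ha) (Localization.Away a),
    fun r => Valuation.extendToLocalization_apply_map_apply _ _ _ r⟩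

section Away

variable (v : Valuation R Γ) {a : R} {w : Valuation (Localization.Away a) Γ}
  (hw : ∀ r, w (algebraMap R (Localization.Away a) r) = v r)
include hw

/-- `w (1/a) = (v a)⁻¹`. [folklore] -/
theorem apply_invSelf : w (Away.invSelf a) = (v a)⁻¹ := by
  have h1 : w (algebraMap R (Localization.Away a) a) * w (Away.invSelf a) = 1 := by
    rw [← Valuation.map_mul, Away.mul_invSelf, Valuation.map_one]
  rw [hw] at h1
  exact (eq_inv_of_mul_eq_one_right h1)

/-- `w (x/a) = v x · (v a)⁻¹`. [folklore] -/
theorem apply_div (x : R) :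
    w (algebraMap R (Localization.Away a) x * Away.invSelf a) = v x * (v a)⁻¹ := by
  rw [Valuation.map_mul, hw, apply_invSelf v hw]

/-- **Uniqueness of the extension to `R[1/a]`**: two valuations of `R[1/a]` with values in `Γ` that agree with `v` on `R` agree.
[folklore] -/
theorem valuation_away_unique (ha : v a ≠ 0) {w' : Valuation (Localization.Away a) Γ}
    (hw' : ∀ r, w' (algebraMap R (Localization.Away a) r) = v r) (z : Localization.Away a) : w' z = w z := by
  obtain ⟨⟨x, s⟩, hz⟩ := IsLocalization.surj (Submonoid.powers a) z
  obtain ⟨n, hn⟩ := s.2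
  have hs : v (s : R) ≠ 0 := by
    rw [← hn, Valuation.map_pow]
    exact pow_ne_zero n ha
  have e1 : w' z * v s = v x := by rw [← hw' s, ← Valuation.map_mul, hz, hw']
  have e2 : w z * v s = v x := by rw [← hw s, ← Valuation.map_mul, hz, hw]
  exact mul_right_cancel₀ hs (e1.trans e2.symm)

/-- **`R[J/a]` lies in the valuation ring of `w`** when `v ≤ 1` on `R` and `v ≤ v a` on `J`: `w z ≤ 1` for `z ∈ R[J/a]`.
[folklore] -/
theorem le_one_of_mem_blowupAlgebra (hR : ∀ r, v r ≤ 1) (ha : v a ≠ 0) {J : Ideal R} (hJ : ∀ x ∈ J, v x ≤ v a)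
    {z : Localization.Away a} (hz : z ∈ blowupAlgebra J a) : w z ≤ 1 := by
  let O : Subalgebra R (Localization.Away a) :=
    { toSubsemiring := w.integer.toSubsemiring
      algebraMap_mem' := fun r => by
        show w (algebraMap R (Localization.Away a) r) ≤ 1
        rw [hw]
        exact hR r }
  have hle : blowupAlgebra J a ≤ O := by
    refine Algebra.adjoin_le ?_
    rintro _ ⟨x, hx, rfl⟩
    show w (algebraMap R (Localization.Away a) x * Away.invSelf a) ≤ 1
    rw [apply_div v hw, mul_inv_le_one_iff ha]
    exact hJ x hx
  exact hle hz

/-- **Existence of the centre `𝔓_v = {w < 1} ∩ R[J/a]`**, a prime ideal of `R[J/a]`. [folklore] -/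
theorem exists_centre (hR : ∀ r, v r ≤ 1) (ha : v a ≠ 0) {J : Ideal R} (hJ : ∀ x ∈ J, v x ≤ v a) :
    ∃ 𝔓 : Ideal (blowupAlgebra J a), 𝔓.IsPrime ∧ ∀ z : blowupAlgebra J a, z ∈ 𝔓 ↔ w (z : Localization.Away a) < 1 := by
  have hint : ∀ z : blowupAlgebra J a, w (z : Localization.Away a) ≤ 1 :=
    fun z => le_one_of_mem_blowupAlgebra v hw hR ha hJ z.2
  let P : Ideal (blowupAlgebra J a) :=
    { carrier := {z | w (z : Localization.Away a) < 1}
      add_mem' := fun {x y} hx hy => by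
        show w ((x : Localization.Away a) + y) < 1
        exact lt_of_le_of_lt (w.map_add _ _) (max_lt hx hy)
      zero_mem' := by
        show w ((0 : blowupAlgebra J a) : Localization.Away a) < 1
        simp
      smul_mem' := fun c x hx => by
        show w ((c : Localization.Away a) * x) < 1
        rw [Valuation.map_mul]
        exact mul_lt_one_of_le_of_lt (hint c) hx }
  refine ⟨P, ⟨?_, ?_⟩, fun z => Iff.rfl⟩
  · rw [Ideal.ne_top_iff_one]
    show ¬ w ((1 : blowupAlgebra J a) : Localization.Away a) < 1
    simp
  · intro x y hxy
    by_contra h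
    rw [not_or] at h
    obtain ⟨hx, hy⟩ := h
    have ex : w (x : Localization.Away a) = 1 := le_antisymm (hint x) (not_lt.mp hx)
    have ey : w (y : Localization.Away a) = 1 := le_antisymm (hint y) (not_lt.mp hy)
    have h' : w ((x : Localization.Away a) * y) < 1 := hxy
    rw [Valuation.map_mul, ex, ey, one_mul] at h'
    exact lt_irrefl _ h'

/-! ## Membership rules for the centre (any ideal `𝔓` with `z ∈ 𝔓 ↔ w z < 1`) -/

variable {J : Ideal R} {𝔓 : Ideal (blowupAlgebra J a)}
  (h𝔓 : ∀ z : blowupAlgebra J a, z ∈ 𝔓 ↔ w (z : Localization.Away a) < 1)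
include h𝔓

/-- `r/1 ∈ 𝔓_v ↔ v r < 1`: the centre of `w` on `R[J/a]` contracts to the centre of `v` on `R`. [folklore] -/
theorem algebraMap_mem_centre_iff (r : R) : algebraMap R (blowupAlgebra J a) r ∈ 𝔓 ↔ v r < 1 := by
  rw [h𝔓, ← hw r]
  rfl

/-- `M · R[J/a] ≤ 𝔓_v ↔ v < 1` on `M` (for `M = 𝔪` and `v` centred at `𝔪`: hypothesis `hM` of K-RIBBON-BAD). [folklore] -/
theorem map_le_centre_iff (M : Ideal R) :
    M.map (algebraMap R (blowupAlgebra J a)) ≤ 𝔓 ↔ ∀ r ∈ M, v r < 1 := by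
  rw [Ideal.map_le_iff_le_comap]
  constructor
  · intro h r hr
    exact (algebraMap_mem_centre_iff v hw h𝔓 r).mp (h hr)
  · intro h r hr
    exact (algebraMap_mem_centre_iff v hw h𝔓 r).mpr (h r hr)

/-- **The hyperplane `{g/a = 0}`**: for `g ∈ J`, `g/a ∈ 𝔓_v ↔ v g < v a`. [folklore] -/
theorem div_mem_centre_iff (ha : v a ≠ 0) {g : R} (hg : g ∈ J) :
    (⟨algebraMap R (Localization.Away a) g * Away.invSelf a, div_mem_blowupAlgebra J a hg⟩ : blowupAlgebra J a) ∈ 𝔓 ↔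
      v g < v a := by
  rw [h𝔓]
  show w (algebraMap R (Localization.Away a) g * Away.invSelf a) < 1 ↔ _
  rw [apply_div v hw, mul_inv_lt_one_iff ha]

/-- **The hyperplane `{g/a = 0}`, def-free form of K-RIBBON-BAD**: for `g ∈ J`, `g/1 ∈ 𝔓_v · (a) ↔ v g < v a`
(`a` is a non-zero-divisor of `R[J/a]`, Stacks 07Z3 (1)). [folklore] -/
theorem algebraMap_mem_centre_mul_span_iff (ha : v a ≠ 0) {g : R} (hg : g ∈ J) :
    algebraMap R (blowupAlgebra J a) g ∈ 𝔓 * Ideal.span {algebraMap R (blowupAlgebra J a) a} ↔ v g < v a := by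
  rw [Ideal.mem_mul_span_singleton, ← div_mem_centre_iff v hw h𝔓 ha hg]
  set q : blowupAlgebra J a :=
    ⟨algebraMap R (Localization.Away a) g * Away.invSelf a, div_mem_blowupAlgebra J a hg⟩ with hq
  have e : q * algebraMap R (blowupAlgebra J a) a = algebraMap R (blowupAlgebra J a) g := by
    apply Subtype.ext
    show algebraMap R (Localization.Away a) g * Away.invSelf a * algebraMap R (Localization.Away a) a =
      algebraMap R (Localization.Away a) g
    exact div_mul_algebraMap a g
  have hnzd : algebraMap R (blowupAlgebra J a) a ∈ nonZeroDivisors (blowupAlgebra J a) :=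
    algebraMap_mem_nonZeroDivisors_blowupAlgebra (I := J) (a := a)
  constructor
  · rintro ⟨z, hz, hzg⟩
    have hza : z * algebraMap R (blowupAlgebra J a) a = q * algebraMap R (blowupAlgebra J a) a := hzg.trans e.symm
    have hz' : z = q := (mul_cancel_right_mem_nonZeroDivisors hnzd).mp hza
    rw [← hz']
    exact hz
  · intro h
    exact ⟨q, h, e⟩

/-- **Local form**: if `R` is local and `v` is centred at `𝔪` (`v r < 1 ↔ r ∈ 𝔪`), then `𝔓_v ∩ R = 𝔪` and `𝔪 · R[J/a] ≤ 𝔓_v`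
(hypotheses `h𝔓` / `hM` of `RibbonBad.exists_point_varpiGerm_mem_sq_of_chart_prime` / `exists_point_bad_of_ribbon`). [folklore] -/
theorem comap_centre_eq_maximalIdeal [IsLocalRing R] (hcent : ∀ r, v r < 1 ↔ r ∈ maximalIdeal R) :
    𝔓.comap (algebraMap R (blowupAlgebra J a)) = maximalIdeal R ∧
      (maximalIdeal R).map (algebraMap R (blowupAlgebra J a)) ≤ 𝔓 := by
  constructor
  · ext r
    rw [Ideal.mem_comap, algebraMap_mem_centre_iff v hw h𝔓, hcent]
  · rw [map_le_centre_iff v hw h𝔓]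
    exact fun r hr => (hcent r).mpr hr

omit h𝔓 in
/-- **Every `Γ`-valued valuation of `R[J/a]` extending `v` is the restriction of `w`** (the chart ring has the same total ring
of fractions as far as `a` is concerned: `z · aⁿ ∈ R` for `z ∈ R[J/a]`). [folklore] -/
theorem valuation_blowupAlgebra_unique (ha : v a ≠ 0) {w' : Valuation (blowupAlgebra J a) Γ}
    (hw' : ∀ r, w' (algebraMap R (blowupAlgebra J a) r) = v r) (z : blowupAlgebra J a) :
    w' z = w (z : Localization.Away a) := by
  obtain ⟨⟨x, s⟩, hz⟩ := IsLocalization.surj (Submonoid.powers a) (z : Localization.Away a)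
  obtain ⟨n, hn⟩ := s.2
  have hs : v (s : R) ≠ 0 := by
    rw [← hn, Valuation.map_pow]
    exact pow_ne_zero n ha
  have hz' : z * algebraMap R (blowupAlgebra J a) s = algebraMap R (blowupAlgebra J a) x := Subtype.ext hz
  have e1 : w' z * v s = v x := by rw [← hw' s, ← Valuation.map_mul, hz', hw']
  have e2 : w (z : Localization.Away a) * v s = v x := by rw [← hw s, ← Valuation.map_mul, hz, hw]
  exact mul_right_cancel₀ hs (e1.trans e2.symm)

/-- **UNIQUENESS OF THE CENTRE ON THE CHART**: a prime (indeed any ideal) `𝔮` of `R[J/a]` at which SOME `Γ`-valued valuation `w′`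
of `R[J/a]` extending `v` is centred (`z ∈ 𝔮 ↔ w′ z < 1`) is the centre `𝔓_v`. [folklore] -/
theorem centre_unique (ha : v a ≠ 0) {𝔮 : Ideal (blowupAlgebra J a)} {w' : Valuation (blowupAlgebra J a) Γ}
    (hw' : ∀ r, w' (algebraMap R (blowupAlgebra J a) r) = v r) (h𝔮 : ∀ z : blowupAlgebra J a, z ∈ 𝔮 ↔ w' z < 1) :
    𝔮 = 𝔓 := by
  ext z
  rw [h𝔮, h𝔓, valuation_blowupAlgebra_unique v hw ha hw']

/-- **DOMINATION of the local ring at the centre**: `w` extends to any localisation `L` of `R[J/a]` at the prime `𝔓_v` — e.g. the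
stalk of the blown-up scheme at the point corresponding to `𝔓_v` — with `≤ 1` on `L` and `< 1` exactly on the maximal ideal: the
ring-level content of «`v` is centred at that point». [folklore] -/
theorem exists_valuation_atPrime (hR : ∀ r, v r ≤ 1) (ha : v a ≠ 0) (hJ : ∀ x ∈ J, v x ≤ v a) [𝔓.IsPrime]
    (L : Type*) [CommRing L] [IsLocalRing L] [Algebra (blowupAlgebra J a) L] [IsLocalization.AtPrime L 𝔓] :
    ∃ wL : Valuation L Γ, (∀ y, wL y ≤ 1) ∧ (∀ y, wL y < 1 ↔ y ∈ maximalIdeal L) ∧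
      ∀ z : blowupAlgebra J a, wL (algebraMap (blowupAlgebra J a) L z) = w (z : Localization.Away a) := by
  have hint : ∀ z : blowupAlgebra J a, w (z : Localization.Away a) ≤ 1 :=
    fun z => le_one_of_mem_blowupAlgebra v hw hR ha hJ z.2
  -- `w` restricted to the chart ring, and the value `1` off the centre
  let wB : Valuation (blowupAlgebra J a) Γ := w.comap (blowupAlgebra J a).val.toRingHom
  have hwB : ∀ z, wB z = w (z : Localization.Away a) := fun z => rfl
  have hone : ∀ t : blowupAlgebra J a, t ∉ 𝔓 → w (t : Localization.Away a) = 1 := fun t ht =>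
    le_antisymm (hint t) (not_lt.mp (fun h => ht ((h𝔓 t).mpr h)))
  have hS : 𝔓.primeCompl ≤ wB.supp.primeCompl := by
    intro t ht
    show t ∉ wB.supp
    rw [Valuation.mem_supp_iff, hwB, hone t ht]
    exact one_ne_zero
  refine ⟨wB.extendToLocalization hS L, ?_, ?_, fun z => ?_⟩
  · intro y
    obtain ⟨⟨z, t⟩, rfl⟩ := IsLocalization.mk'_surjective 𝔓.primeCompl y
    show wB.extendToLocalization hS L (IsLocalization.mk' L z t) ≤ 1
    rw [Valuation.extendToLocalization_mk', hwB, hwB, hone t t.2, inv_one, mul_one]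
    exact hint z
  · intro y
    obtain ⟨⟨z, t⟩, rfl⟩ := IsLocalization.mk'_surjective 𝔓.primeCompl y
    show wB.extendToLocalization hS L (IsLocalization.mk' L z t) < 1 ↔ IsLocalization.mk' L z t ∈ maximalIdeal L
    rw [Valuation.extendToLocalization_mk', hwB, hwB, hone t t.2, inv_one, mul_one, ← h𝔓,
      IsLocalization.AtPrime.mk'_mem_maximal_iff L 𝔓 z t]
  · rw [Valuation.extendToLocalization_apply_map_apply]
    rfl

end Away

/-! ## The package consumed by K-RIBBON-BAD -/

/-- **K-VAL-CENTRE (the (2a) package).** `R` local, `v : Valuation R Γ` with `v ≤ 1` on `R` and centred at `𝔪` (`v r < 1 ↔ r ∈ 𝔪`),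
`J` an ideal, `a ∈ J` with `v a ≠ 0` and `v ≤ v a` on `J` (the chart of a generator of minimal value), `w` the extension of `v` to
`R[1/a]`, and `g ∈ J` with `v g < v a`. Then the centre `𝔓_v` of `w` on `R[J/a]` is a point of `Spec R[J/a]` OVER `𝔪`
(`𝔓_v ∩ R = 𝔪`, `𝔪 · R[J/a] ≤ 𝔓_v`) ON THE HYPERPLANE `{g/a = 0}` (`g/1 ∈ 𝔓_v · (a)`), with `z ∈ 𝔓_v ↔ w z < 1`. These are
exactly the hypotheses `h𝔓`/`hM`/`hw` of `RibbonBad.exists_point_varpiGerm_mem_sq_of_chart_prime` / `exists_point_bad_of_ribbon`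
(p557704): after a RIBBON touch (`ϖ − g ∈ 𝔪²`) the point of the blowing up under the `v`-centre is BAD. OURS. [folklore] -/
theorem exists_centre_ribbon [IsLocalRing R] (v : Valuation R Γ) (hR : ∀ r, v r ≤ 1)
    (hcent : ∀ r, v r < 1 ↔ r ∈ maximalIdeal R) {J : Ideal R} {a : R} (ha : v a ≠ 0) (hJ : ∀ x ∈ J, v x ≤ v a)
    {w : Valuation (Localization.Away a) Γ} (hw : ∀ r, w (algebraMap R (Localization.Away a) r) = v r)
    {g : R} (hg : g ∈ J) (hvg : v g < v a) :
    ∃ 𝔓 : PrimeSpectrum (blowupAlgebra J a),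
      𝔓.asIdeal.comap (algebraMap R (blowupAlgebra J a)) = maximalIdeal R ∧
      (maximalIdeal R).map (algebraMap R (blowupAlgebra J a)) ≤ 𝔓.asIdeal ∧
      algebraMap R (blowupAlgebra J a) g ∈ 𝔓.asIdeal * Ideal.span {algebraMap R (blowupAlgebra J a) a} ∧
      ∀ z : blowupAlgebra J a, z ∈ 𝔓.asIdeal ↔ w (z : Localization.Away a) < 1 := by
  obtain ⟨𝔓, h𝔓prime, h𝔓⟩ := exists_centre v hw hR ha hJ
  obtain ⟨hcomap, hmap⟩ := comap_centre_eq_maximalIdeal v hw h𝔓 hcent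
  exact ⟨⟨𝔓, h𝔓prime⟩, hcomap, hmap, (algebraMap_mem_centre_mul_span_iff v hw h𝔓 ha hg).mpr hvg, h𝔓⟩

end ValChartCentre

end Summit.ResolutionOfSingularities.ResolutionOfSingularities.Cruxes.EquisingularLiftNat.Sections
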